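import Literature.NumberTheory.Irrationality.Zudilin2004.Lemma19Bricks
import Literature.NumberTheory.Transcendental.NesterenkoBricksPadicDiv
import HarnessLib

/-!
# Zudilin 2004, Lemma 19 for general `𝐡`, II: the `p`-adic estimate (8.11)

Topic `Literature/NumberTheory/Irrationality/Zudilin2004`. Second file of the discharge of
`Literature.NumberTheory.Irrationality.Zudilin2004.lemma19`, following [Zudilin2004, §8, proof of Lemma 19,
(8.11)] (arXiv:math/0206176 p. 20): for a prime `p > √h₀` and a pole index `h_{r+1} ≤ k ≤ h₀ − h_{r+1}`,

  `ord_p (1/j!)(R(t)(t+k)^{q−r})^{(j)}|_{t=−k} ≥ −j + ν_{k,p}`   (`HParams.Gk_isDOrdDiv`, `HParams.padicOrdGe_divDeriv_Gk`)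

with the bracket sum `ν_{k,p}` of (8.9) (`HParams.nuKP`), by the sharp Leibniz rule `IsDOrdDiv.prod` applied to
the brick factorisation of `Lemma19Bricks.lean`: Lemma 17 (`polyBrick_isDOrdDiv`) for the `2r` polynomial bricks
(the first printed form of (7.4) converted by (7.5)), Lemma 18 (`recipBrickReg_isDOrdDiv`, `a₀ = h_{r+1}`,
`b₀ = h₀−h_{r+1}+1`) for the `q − r` reciprocal ones, exponent `≥ 0` for `h₀ + 2t`. Also: `ν_{k,p} ≥ 0`
(each bracket group is a superadditivity defect of `⌊·⌋`), hence `ν_p ≥ 0`, and `ν_p ≤ ν_{k,p}`.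
Everything here is PROVED (no named facts).

## References

* [Zudilin2004] W. Zudilin, *Arithmetic of linear forms involving odd zeta values*, J. Théor. Nombres Bordeaux
  16 (2004), 251–291 = arXiv:math/0206176, §7 Lemmas 17–18, (7.5); §8 (8.9), (8.11).
-/

noncomputable section

open Finset Filter Literature.Analysis.Calculus
open scoped Nat

namespace Literature.NumberTheory.Irrationality.Zudilin2004

open Literature.NumberTheory.Transcendental

namespace HParams

variable (P : HParams)

/-! ### The bracket sum with integer divisions -/

/-- `ν_{k,p}` of (8.9) written with integer divisions `Int.ediv` (= the integer parts of (8.9)).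
[cite: Zudilin2004, §8 (8.9)] -/
def nuKPz (k p : ℕ) : ℤ :=
  (∑ j ∈ Icc 1 P.r,
      (((k : ℤ) - 1) / p + ((P.h 0 : ℤ) - k - 1) / p - ((k : ℤ) - P.h j) / p -
        ((P.h 0 : ℤ) - P.h j - k) / p - 2 * (((P.h j : ℤ) - 1) / p))) +
    ∑ j ∈ Icc (P.r + 1) P.q,
      (((P.h 0 : ℤ) - 2 * P.h j) / p - ((k : ℤ) - P.h j) / p - ((P.h 0 : ℤ) - P.h j - k) / p)

/-- `ν_{k,p}` (rational integer parts) `=` `ν_{k,p}` (integer divisions). [cite: Zudilin2004, §8 (8.9)] -/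
theorem nuKP_eq_nuKPz (k p : ℕ) : P.nuKP k p = P.nuKPz k p := by
  simp only [nuKP, nuKPz, ← Rat.floor_intCast_div_natCast]
  push_cast
  rfl

/-- `ν_{k,p} ≥ 0`: each bracket group in (8.9) is `⌊x+y⌋ − ⌊x⌋ − ⌊y⌋ ≥ 0`. [cite: Zudilin2004, §8 (8.9)] -/
theorem nuKP_nonneg (k p : ℕ) : 0 ≤ P.nuKP k p := by
  unfold nuKP
  refine add_nonneg (sum_nonneg fun j _ => ?_) (sum_nonneg fun j _ => ?_)
  · have h1 := Int.le_floor_add (((k : ℚ) - P.h j) / p) (((P.h j : ℚ) - 1) / p)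
    have h2 := Int.le_floor_add (((P.h 0 : ℚ) - P.h j - k) / p) (((P.h j : ℚ) - 1) / p)
    rw [show ((k : ℚ) - P.h j) / p + ((P.h j : ℚ) - 1) / p = ((k : ℚ) - 1) / p by ring] at h1
    rw [show ((P.h 0 : ℚ) - P.h j - k) / p + ((P.h j : ℚ) - 1) / p = ((P.h 0 : ℚ) - k - 1) / p by ring]
      at h2
    linarith
  · have h1 := Int.le_floor_add (((k : ℚ) - P.h j) / p) (((P.h 0 : ℚ) - P.h j - k) / p)
    rw [show ((k : ℚ) - P.h j) / p + ((P.h 0 : ℚ) - P.h j - k) / p = ((P.h 0 : ℚ) - 2 * P.h j) / p by ring]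
      at h1
    linarith

/-- `ν_p ≤ ν_{k,p}` for `h_{r+1} ≤ k ≤ h₀ − h_{r+1}`. [cite: Zudilin2004, §8 (8.9)] -/
theorem nuP_le_nuKP {k : ℕ} (p : ℕ) (hk : k ∈ Icc (P.h (P.r + 1)) (P.h 0 - P.h (P.r + 1))) :
    P.nuP p ≤ P.nuKP k p := by
  unfold nuP
  rw [dif_pos ⟨k, hk⟩]
  exact inf'_le _ hk

/-- `ν_p ≥ 0`. [cite: Zudilin2004, §8 (8.9)] -/
theorem nuP_nonneg (p : ℕ) : 0 ≤ P.nuP p := by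
  unfold nuP
  split_ifs with hne
  · obtain ⟨k, hk, hmin⟩ := exists_mem_eq_inf' hne fun k => P.nuKP k p
    rw [hmin]
    exact P.nuKP_nonneg k p
  · exact le_rfl

/-! ### (8.11) -/

variable {P}

/-- The factor `h₀ + 2t` has `IsDOrdDiv p 0` at every integer point. [cite: Zudilin2004, §8 Lemma 19 (proof)] -/
theorem isDOrdDiv_wpFactor (p : ℕ) [Fact p.Prime] (N k : ℕ) :
    IsDOrdDiv p 0 N (fun t : ℚ => (P.h 0 : ℚ) + 2 * t) (-(k : ℚ)) := by
  have h := (isDOrdDiv_two_mul_add_const p (c := (P.h 0 : ℚ)) (x := -(k : ℚ)) ((P.h 0 : ℤ) - 2 * k)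
    (by push_cast; ring) N).mono (e' := 0) (by split_ifs <;> omega)
  exact h.congr (Eventually.of_forall fun t => by ring)

/-- Lemma 17 for the bricks `R(h_j,1;t)`, `j ≤ r`, at `t = −k`, `p² > h₀`: exponent
`Σ_{j≤r} (⌊(k−1)/p⌋ − ⌊(k−h_j)/p⌋ − ⌊(h_j−1)/p⌋)` ((7.4), second form). [cite: Zudilin2004, §7 Lemma 17, §8 (8.11)] -/
theorem isDOrdDiv_polyBricks₁ (hV : P.Valid) (p : ℕ) [hp : Fact p.Prime] (hp2 : P.h 0 < p ^ 2) (N k : ℕ) :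
    IsDOrdDiv p (∑ j ∈ Icc 1 P.r, (((k : ℤ) - 1) / p - ((k : ℤ) - P.h j) / p - ((P.h j : ℤ) - 1) / p)) N
      (fun t => ∏ j ∈ Icc 1 P.r, polyBrick 1 (P.h j - 1) t) (-(k : ℚ)) := by
  have hrq := hV.r_add_four_le
  have hp0 : (0 : ℤ) < p := by exact_mod_cast hp.out.pos
  refine IsDOrdDiv.prod _ fun j hj => ?_
  have hj' := mem_Icc.1 hj
  have h1j := hV.one_le_h (j := j) (by omega)
  have h2j := hV.two_mul_h_lt hj'.1 (by omega)
  have h := polyBrick_isDOrdDiv p (1 : ℤ) (P.h j - 1) ((show P.h j - 1 ≤ P.h 0 by omega).trans_lt hp2)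
    (k : ℤ) N
  rw [Int.cast_natCast] at h
  refine h.mono (le_of_eq ?_)
  have e1 := Int.neg_sub_one_ediv_eq ((k : ℤ) - P.h j) hp0
  have e2 := Int.neg_sub_one_ediv_eq ((k : ℤ) - 1) hp0
  have c1 : (1 + ((P.h j - 1 : ℕ) : ℤ) - 1 - k) = -((k : ℤ) - P.h j) - 1 := by omega
  have c2 : ((1 : ℤ) - 1 - k) = -((k : ℤ) - 1) - 1 := by ring
  have c3 : ((P.h j - 1 : ℕ) : ℤ) = (P.h j : ℤ) - 1 := by omega
  rw [c1, c2, c3, e1, e2]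
  ring

/-- Lemma 17 for the bricks `R(h₀,h₀−h_j+1;t)`, `j ≤ r`, at `t = −k`, `p² > h₀`: exponent
`Σ_{j≤r} (⌊(h₀−k−1)/p⌋ − ⌊(h₀−h_j−k)/p⌋ − ⌊(h_j−1)/p⌋)` ((7.4), first form). [cite: Zudilin2004, §7 Lemma 17, §8 (8.11)] -/
theorem isDOrdDiv_polyBricks₂ (hV : P.Valid) (p : ℕ) [hp : Fact p.Prime] (hp2 : P.h 0 < p ^ 2) (N k : ℕ) :
    IsDOrdDiv p
      (∑ j ∈ Icc 1 P.r, (((P.h 0 : ℤ) - k - 1) / p - ((P.h 0 : ℤ) - P.h j - k) / p - ((P.h j : ℤ) - 1) / p)) N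
      (fun t => ∏ j ∈ Icc 1 P.r, polyBrick ((P.h 0 - P.h j + 1 : ℕ) : ℤ) (P.h j - 1) t) (-(k : ℚ)) := by
  have hrq := hV.r_add_four_le
  refine IsDOrdDiv.prod _ fun j hj => ?_
  have hj' := mem_Icc.1 hj
  have h1j := hV.one_le_h (j := j) (by omega)
  have h2j := hV.two_mul_h_lt hj'.1 (by omega)
  have h := polyBrick_isDOrdDiv p (((P.h 0 - P.h j + 1 : ℕ) : ℤ)) (P.h j - 1)
    ((show P.h j - 1 ≤ P.h 0 by omega).trans_lt hp2) (k : ℤ) N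
  rw [Int.cast_natCast] at h
  refine h.mono (le_of_eq ?_)
  have c1 : (((P.h 0 - P.h j + 1 : ℕ) : ℤ) + ((P.h j - 1 : ℕ) : ℤ) - 1 - k) = (P.h 0 : ℤ) - k - 1 := by omega
  have c2 : (((P.h 0 - P.h j + 1 : ℕ) : ℤ) - 1 - k) = (P.h 0 : ℤ) - P.h j - k := by omega
  have c3 : ((P.h j - 1 : ℕ) : ℤ) = (P.h j : ℤ) - 1 := by omega
  rw [c1, c2, c3]

/-- Lemma 18 for the regularised reciprocal bricks `R(h_j,h₀−h_j+1;t)(t+k)`, `j > r`, at `t = −k`,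
`h_{r+1} ≤ k ≤ h₀−h_{r+1}`, `p² > h₀`: exponent `Σ_{j>r} (⌊(h₀−2h_j)/p⌋ − ⌊(k−h_j)/p⌋ − ⌊(h₀−h_j−k)/p⌋)` ((7.7)).
[cite: Zudilin2004, §7 Lemma 18, §8 (8.11)] -/
theorem isDOrdDiv_recipBricks (hV : P.Valid) (p : ℕ) [hp : Fact p.Prime] (hp2 : P.h 0 < p ^ 2) {k : ℕ}
    (hk₁ : P.h (P.r + 1) ≤ k) (hk₂ : k ≤ P.h 0 - P.h (P.r + 1)) (N : ℕ) :
    IsDOrdDiv p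
      (∑ j ∈ Icc (P.r + 1) P.q,
        (((P.h 0 : ℤ) - 2 * P.h j) / p - ((k : ℤ) - P.h j) / p - ((P.h 0 : ℤ) - P.h j - k) / p)) N
      (fun t => ∏ j ∈ Icc (P.r + 1) P.q, recipBrickReg (P.h j : ℤ) (P.h 0 - 2 * P.h j + 1) (k : ℤ) t)
      (-(k : ℚ)) := by
  have hrq := hV.r_add_four_le
  have h2r : 2 * P.h (P.r + 1) < P.h 0 := hV.two_mul_h_lt (by omega) (by omega)
  have hp2' : (P.h 0 : ℤ) < (p : ℤ) ^ 2 := by exact_mod_cast hp2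
  refine IsDOrdDiv.prod _ fun j hj => ?_
  have hj' := mem_Icc.1 hj
  have h2j : 2 * P.h j < P.h 0 := hV.two_mul_h_lt (by omega) hj'.2
  have hjr : P.h (P.r + 1) ≤ P.h j := hV.h_mono (by omega) hj'.1 hj'.2
  have h := recipBrickReg_isDOrdDiv p (a₀ := (P.h (P.r + 1) : ℤ)) (b₀ := (P.h 0 : ℤ) - P.h (P.r + 1) + 1)
    (a := (P.h j : ℤ)) (m := P.h 0 - 2 * P.h j + 1) (k := (k : ℤ)) (by omega) (by exact_mod_cast hjr)
    (by omega) (by exact_mod_cast hk₁) (by omega) (by linarith) N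
  rw [Int.cast_natCast] at h
  refine h.mono (le_of_eq ?_)
  have c1 : (((P.h 0 - 2 * P.h j + 1 : ℕ) : ℤ) - 1) = (P.h 0 : ℤ) - 2 * P.h j := by omega
  have c2 : ((P.h j : ℤ) + ((P.h 0 - 2 * P.h j + 1 : ℕ) : ℤ) - 1 - k) = (P.h 0 : ℤ) - P.h j - k := by omega
  rw [c1, c2]

/-- **(8.11)** ([Zudilin2004, proof of Lemma 19]): for a prime `p` with `p² > h₀`, a pole index
`h_{r+1} ≤ k ≤ h₀ − h_{r+1}` and every `N`: `ord_p (1/j!)(R(t)(t+k)^{q−r})^{(j)}|_{t=−k} ≥ −j + ν_{k,p}` for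
`j ≤ N`, i.e. `IsDOrdDiv p ν_{k,p} N (Gk P k) (−k)`. [cite: Zudilin2004, §8 (8.11)] -/
theorem Gk_isDOrdDiv (hV : P.Valid) (p : ℕ) [hp : Fact p.Prime] (hp2 : P.h 0 < p ^ 2) {k : ℕ}
    (hk₁ : P.h (P.r + 1) ≤ k) (hk₂ : k ≤ P.h 0 - P.h (P.r + 1)) (N : ℕ) :
    IsDOrdDiv p (P.nuKP k p) N (P.Gk k) (-(k : ℚ)) := by
  have h := (((isDOrdDiv_wpFactor (P := P) p N k).mul (isDOrdDiv_polyBricks₁ hV p hp2 N k)).mul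
    (isDOrdDiv_polyBricks₂ hV p hp2 N k)).mul (isDOrdDiv_recipBricks hV p hp2 hk₁ hk₂ N)
  refine (h.mono (le_of_eq ?_)).congr (Eventually.of_forall fun t => rfl)
  rw [nuKP_eq_nuKPz]
  simp only [nuKPz, zero_add, ← sum_add_distrib]
  congr 1
  exact sum_congr rfl fun j _ => by ring

/-- (8.11) for one coefficient: `ord_p (1/a!)(R(t)(t+k)^{q−r})^{(a)}|_{t=−k} ≥ ν_{k,p} − a`.
[cite: Zudilin2004, §8 (8.11)] -/
theorem padicOrdGe_divDeriv_Gk (hV : P.Valid) (p : ℕ) [hp : Fact p.Prime] (hp2 : P.h 0 < p ^ 2) {k : ℕ}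
    (hk₁ : P.h (P.r + 1) ≤ k) (hk₂ : k ≤ P.h 0 - P.h (P.r + 1)) (a : ℕ) :
    PadicOrdGe p (P.nuKP k p - a) (divDeriv a (P.Gk k) (-(k : ℚ))) :=
  (Gk_isDOrdDiv hV p hp2 hk₁ hk₂ a).padicOrdGe le_rfl

end HParams

end Literature.NumberTheory.Irrationality.Zudilin2004
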